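import Mathlib
import Summits.Ventures.HodgeRepro2.CyclotomicSevenSubfields
import Summits.Ventures.HodgeRepro2.T5CyclotomicDyadic
import Summits.Ventures.HodgeRepro2.T5CyclicSubfieldGalois

/-!
# T5CyclotomicSevenDyadic — N2.8.2(e)'s first example on the concrete field `K7 = ℚ(ζ₇)`

Tier-5 support (seat p3) for sub-step N2 of `route/T5-N2-route-3.md`, §N2.8.2(e): «ℚ(ζ₇) —
ord_7(2) = 3 ⟹ g₂ = 1; −7 ≡ 1 (mod 8) ⟹ 2 splits in ℚ(√−7) ⟹ |D| = 0 ✓ (N2.2.5)».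

`T5CyclotomicDyadic` (p394543) proved the example for ANY field with `IsCyclotomicExtension {7} ℚ E`
and ANY intermediate fields of degree `3` / `2`; p1's `CyclotomicSeven` / `CyclotomicSevenSubfields`
(p394053 / p394279) provide the concrete `K7 := CyclotomicField 7 ℚ`, its real cubic subfield
`realSubfield` (`finrank_realSubfield = 3`) and the unique quadratic subfield
(`existsUnique_quadratic_K7`).  This file instantiates: in `K7`, every prime above `2` has
`e = 1`, `f = 3`, two primes above `2`; in `K7⁺ = realSubfield`, `2` is INERT (one prime, `f = 3`,
«`g₂ = 1`»), that prime splits in `K7` (two primes above it), so `D = ∅` («`|D| = 0`»); in the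
quadratic subfield `2` SPLITS (two primes); and `K7⁺` is a cyclic cubic in the literal sense
(Galois over `ℚ` with cyclic Galois group of order `3`, via `T5CyclicSubfieldGalois`).

Nothing new is proved here beyond the instantiation; uses an L-value-free non-vanishing device:
NO (README §8(d)).
-/

namespace Summit.Ventures.HodgeRepro2.T5CyclotomicSevenDyadic

open Ideal NumberField CyclotomicSeven

/-- The ideal `(2)` of `ℤ`. -/
local notation3 "𝒑₂" => (span {((2 : ℕ) : ℤ)} : Ideal ℤ)

/-- In `K7 = ℚ(ζ₇)`, every prime above `2` has inertia degree `3`. -/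
theorem inertiaDeg_two (P : Ideal (𝓞 K7)) [P.IsPrime] [P.LiesOver 𝒑₂] : P.inertiaDeg ℤ = 3 :=
  T5CyclotomicDyadic.inertiaDeg_two_seven K7 P

/-- In `K7`, `2` is unramified. -/
theorem ramificationIdx_two (P : Ideal (𝓞 K7)) [P.IsPrime] [P.LiesOver 𝒑₂] :
    P.ramificationIdx ℤ = 1 :=
  T5CyclotomicDyadic.ramificationIdx_two_seven K7 P

/-- `K7` has exactly two primes above `2`. -/
theorem ncard_primesOver_two : (𝒑₂.primesOver (𝓞 K7)).ncard = 2 :=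
  T5CyclotomicDyadic.ncard_primesOver_two_seven K7

/-- In `K7⁺ = realSubfield`, every prime above `2` has `f = 3` and `e = 1`. -/
theorem inertiaDeg_two_realSubfield (𝔭 : Ideal (𝓞 realSubfield)) [𝔭.IsPrime] [𝔭.LiesOver 𝒑₂] :
    𝔭.inertiaDeg ℤ = 3 ∧ 𝔭.ramificationIdx ℤ = 1 :=
  T5CyclotomicDyadic.inertiaDeg_two_cubic_seven K7 realSubfield finrank_realSubfield 𝔭

/-- `2` is INERT in `K7⁺`: exactly one prime above `2` («`ord_7(2) = 3 ⟹ g₂ = 1`»). -/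
theorem ncard_primesOver_two_realSubfield : (𝒑₂.primesOver (𝓞 realSubfield)).ncard = 1 :=
  T5CyclotomicDyadic.ncard_primesOver_two_cubic_seven K7 realSubfield finrank_realSubfield

/-- The dyadic prime of `K7⁺` SPLITS in `K7`: two primes of `𝓞 K7` above it. -/
theorem ncard_primesOver_realSubfield (𝔭 : Ideal (𝓞 realSubfield)) [𝔭.IsPrime] [𝔭.LiesOver 𝒑₂] :
    (𝔭.primesOver (𝓞 K7)).ncard = 2 :=
  T5CyclotomicDyadic.ncard_primesOver_cubic_seven K7 realSubfield finrank_realSubfield 𝔭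

/-- `D = ∅` for `K7`: no dyadic place of `K7⁺` is non-split in `K7` («`|D| = 0`», N2.2.5). -/
theorem nonSplit_realSubfield :
    {𝔭 ∈ 𝒑₂.primesOver (𝓞 realSubfield) | (𝔭.primesOver (𝓞 K7)).ncard = 1} = ∅ :=
  T5CyclotomicDyadic.nonSplit_seven K7 realSubfield finrank_realSubfield

/-- The unique quadratic subfield of `K7` (`ℚ(√−7)`) has `2` SPLIT: exactly two primes above `2`
(«`−7 ≡ 1 (mod 8) ⟹ 2 splits in ℚ(√−7)`»). -/
theorem exists_quadratic_two_splits :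
    ∃ K : IntermediateField ℚ K7, Module.finrank ℚ K = 2 ∧ (𝒑₂.primesOver (𝓞 K)).ncard = 2 := by
  obtain ⟨K, hK, -⟩ := existsUnique_quadratic_K7
  exact ⟨K, hK, T5CyclotomicDyadic.ncard_primesOver_two_quadratic_seven K7 K hK⟩

/-- In EVERY quadratic subfield of `K7` (there is exactly one), every prime above `2` has
`e = f = 1`. -/
theorem inertiaDeg_two_quadratic (K : IntermediateField ℚ K7) (hK : Module.finrank ℚ K = 2)
    (𝔮 : Ideal (𝓞 K)) [𝔮.IsPrime] [𝔮.LiesOver 𝒑₂] :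
    𝔮.inertiaDeg ℤ = 1 ∧ 𝔮.ramificationIdx ℤ = 1 :=
  T5CyclotomicDyadic.inertiaDeg_two_quadratic_seven K7 K hK 𝔮

/-- `K7⁺` is a cyclic cubic in the literal sense: Galois over `ℚ` with cyclic Galois group of
order `3` (`T5CyclicSubfieldGalois.isCyclicCubic`, with p1's `IsGalois ℚ K7` and
`IsCyclic Gal(K7/ℚ)` instances). -/
theorem isCyclicCubic_realSubfield :
    IsGalois ℚ realSubfield ∧ IsCyclic (realSubfield ≃ₐ[ℚ] realSubfield) ∧
      Nat.card (realSubfield ≃ₐ[ℚ] realSubfield) = 3 :=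
  T5CyclicSubfieldGalois.isCyclicCubic K7 realSubfield finrank_realSubfield

end Summit.Ventures.HodgeRepro2.T5CyclotomicSevenDyadic
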